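import Summits.Ventures.QEC.Census.BB.A1s_n180_k48_73c9e5d1
import Summits.Ventures.QEC.Census.BB.BBRows
import Summits.Ventures.QEC.Census.BB.Claims
import Literature.InformationTheory.QuantumCodes.TwoBlockConnectedComponents
import Literature.InformationTheory.QuantumCodes.TwoBlockToricLayout
import Literature.InformationTheory.QuantumCodes.TwoBlockWheelComponents
import HarnessLib
import HarnessLib.Audit.Tags
import Summits.Ventures.QEC.Census.BB.A1s_n18_k4_63a6067b

/-!
# Census rows as TYPED two-block codes `QC(A, B)` on `ℤ_ℓ × ℤ_m` — bridge batch `A1sRowsQC1` (2 row(s), kernel tier)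

Family: BB (cell A.1 leaders; qec-search-3 sweep, qec-search-7 one-module certificates). For each KERNEL-std census row below (an EXPLICIT matrix code
`cert.code _ = CSSCode.ofMatrices (rowMatrix n cert.HX) (rowMatrix n cert.HZ)` with `IsCode n k d` certified in its own module), this file
puts the row's CONSTRUCTION into the kernel statement, as in the pilot `Census/BB/A1s_n144_k32_4addf704QC.lean` (p511732):
monomial lists `la`, `lb` (from the certificate's `code.construction`, monomials `xⁱyʲ` as `[i,j]`, convention of BCGMRY24 §4 =
`BivariateBicycleCodes.lean`), the typed object `qc : BB.Code ℓ m := ⟨polyL la, polyL lb⟩`, the kernel INDEX IDENTITIES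
`cert.HX = BBRows.rowsX la lb`, `cert.HZ = BBRows.rowsZ la lb` (`decide`; verified row generator `Census/BB/BBRows.lean`, p502918), the flat
identities via `BBRows.rowMatrix_rowsX/Z`, the transport of the row's own `dZ_eq` / `k_eq` by type-05's `BB.Code.dZ_eq_of_flat` /
`k_eq_of_flat` to `qc_hasParams : BB.HasParams qc n k d` (census predicate of family BB, `Census/BB/Claims.lean`, distance EXACT) and
`qc_isCode : qc.css.IsCode n k d`; and the census LAYOUT columns (Bravyi et al. 2024 §5) as KERNEL verdicts: «connected» —
`qc_tannerGraph_connected` (Lemma 3, `BB.Code.tannerGraph_connected_of_unit_mem`, explicit multiples of exponent differences) or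
`qc_tannerGraph_not_connected` + `card_expDiffSubgroup` + `qc_card_connectedComponent` (`⟨S⟩` = an explicit finite carrier `diffList`,
both inclusions certified; exact component count by Lemma 3 (ii), `BB.Code.card_connectedComponent_mul_card`; by the tree's connected
normal form `TwoBlockConnectedComponents.lean` such a code is the disjoint union of that many copies of its root code); «toric layout» —
`qc_hasToricLayoutWith μ λ` (Lemma 4, `BB.Code.hasToricLayoutWith_of_exponents`; omitted when its sufficient condition has no witness);
«wheel layers» — `qc_wheel_layers` (Lemma 2 minus planarity, `BB.Code.exists_wheel_layers`, weight-(3,3) rows only):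

* `A1s_n180_k48_73c9e5d1` = `QC(y^12 + x + x^4, y^6 + x^2 + x^3)` on `ℤ_5 × ℤ_18`: `[[180, 48, 4]]`; Tanner graph NOT connected, 6 components (= 6 × [[30, 8, 4]]); wheel layers 10/30
* `A1s_n18_k4_63a6067b` = `QC(1 + y + x, 1 + y^2 + x^2)` on `ℤ_3 × ℤ_3`: `[[18, 4, 4]]`; Tanner graph connected; toric layout (3,3); wheel layers 6/6

No new certificate — tier KERNEL, axioms standard, no `native_decide`. HONEST FRAMING: identifies already-certified census objects with
named algebraic constructions and decides structural (graph) properties; the census comparator columns (printed values, optimality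
words) are not touched; «= c × [[n/c, k/c, d]]» is the numerical reading of the certified component count (the per-component code is
identified by the normal form; its own parameters are not re-certified here); planarity/thickness is not asserted. Generated by
qec-type-05's `tools/emit_qc_bridge.py` + `tools/conn_cert.py` (HOME/lean/type-05/tools/).
-/

namespace Summit.Ventures.QEC.Census.A1s_n180_k48_73c9e5d1

open Matrix Literature.InformationTheory.QuantumCodes BBRows

/-- Monomials of `A = y^12 + x + x^4` (certificate `A_terms = [[0, 12], [1, 0], [4, 0]]`). DATA. -/
def la : List (BB.Mono 5 18) := [(Fin.ofNat 5 0, Fin.ofNat 18 12), (Fin.ofNat 5 1, Fin.ofNat 18 0), (Fin.ofNat 5 4, Fin.ofNat 18 0)]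

/-- Monomials of `B = y^6 + x^2 + x^3` (certificate `B_terms = [[0, 6], [2, 0], [3, 0]]`). DATA. -/
def lb : List (BB.Mono 5 18) := [(Fin.ofNat 5 0, Fin.ofNat 18 6), (Fin.ofNat 5 2, Fin.ofNat 18 0), (Fin.ofNat 5 3, Fin.ofNat 18 0)]

/-- The census row's code as a TYPED two-block code `QC(y^12 + x + x^4, y^6 + x^2 + x^3)` on `ℤ_5 × ℤ_18` (`BB.Code 5 18`). (definition) -/
def qc : BB.Code 5 18 := ⟨polyL la, polyL lb⟩

set_option maxRecDepth 100000 in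
/-- INDEX IDENTITY, `X` side, in the kernel: the certificate's `H^X` rows ARE the `X`-check words of `qc` (`decide +kernel`). -/
theorem HX_eq_rowsX : A1s_n180_k48_73c9e5d1.cert.HX = rowsX la lb := by
  decide +kernel

set_option maxRecDepth 100000 in
/-- INDEX IDENTITY, `Z` side. -/
theorem HZ_eq_rowsZ : A1s_n180_k48_73c9e5d1.cert.HZ = rowsZ la lb := by
  decide +kernel

set_option maxRecDepth 100000 in
/-- The certificate's flat `H^X` is `qc.HXFlat`. -/
theorem rowMatrix_HX_eq : rowMatrix 180 A1s_n180_k48_73c9e5d1.cert.HX = qc.HXFlat := by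
  have cast : ∀ {H H' : List ℕ} (e : H = H'),
      rowMatrix 180 H = (rowMatrix 180 H').submatrix (Fin.cast (congrArg List.length e)) id := by
    intro H H' e; subst e; rfl
  exact (cast HX_eq_rowsX).trans (rowMatrix_rowsX qc (LA := la) (LB := lb) rfl rfl)

set_option maxRecDepth 100000 in
/-- The certificate's flat `H^Z` is `qc.HZFlat`. -/
theorem rowMatrix_HZ_eq : rowMatrix 180 A1s_n180_k48_73c9e5d1.cert.HZ = qc.HZFlat := by
  have cast : ∀ {H H' : List ℕ} (e : H = H'),
      rowMatrix 180 H = (rowMatrix 180 H').submatrix (Fin.cast (congrArg List.length e)) id := by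
    intro H H' e; subst e; rfl
  exact (cast HZ_eq_rowsZ).trans (rowMatrix_rowsZ qc (LA := la) (LB := lb) rfl rfl)

set_option maxRecDepth 100000 in
/-- `d^Z (qc) = 4`, transported from the census certificate (`A1s_n180_k48_73c9e5d1.dZ_eq`) by `BB.Code.dZ_eq_of_flat`. -/
theorem qc_dZ : qc.css.dZ = 4 :=
  (qc.dZ_eq_of_flat (D := A1s_n180_k48_73c9e5d1.cert.code A1s_n180_k48_73c9e5d1.commOK_cert)
    rowMatrix_HX_eq rowMatrix_HZ_eq).symm.trans A1s_n180_k48_73c9e5d1.dZ_eq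

set_option maxRecDepth 100000 in
/-- `k (qc) = 48`, transported from the census certificate (`A1s_n180_k48_73c9e5d1.k_eq`) by `BB.Code.k_eq_of_flat`. -/
theorem qc_k : qc.k = 48 :=
  (qc.k_eq_of_flat (D := A1s_n180_k48_73c9e5d1.cert.code A1s_n180_k48_73c9e5d1.commOK_cert)
    rowMatrix_HX_eq rowMatrix_HZ_eq).symm.trans A1s_n180_k48_73c9e5d1.k_eq

/-- **`QC(y^12 + x + x^4, y^6 + x^2 + x^3)` on `ℤ_5 × ℤ_18` has parameters `[[180, 48, 4]]`** (distance exact; `BB.HasParams`) — the census row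
`A1s_n180_k48_73c9e5d1` read as a statement about the construction. KERNEL. -/
theorem qc_hasParams : Summit.Ventures.QEC.BB.HasParams qc 180 48 4 :=
  BB.hasParams_of_dZ (by simp only [BB.numQubits_eq]) qc_k qc_dZ

/-- The same in the generic census vocabulary: `qc.css.IsCode 180 48 4`. -/
theorem qc_isCode : qc.css.IsCode 180 48 4 :=
  (BB.hasParams_iff_isCode (by decide)).1 qc_hasParams


/-! ### Connectivity: this row is DISCONNECTED (`|⟨S⟩| = 15` of `ℓm = 90` ⇒ `6` components by Lemma 3 (ii)) -/

/-- The exponent-difference subgroup `⟨S⟩` of `qc` as an explicit finite carrier (15 elements, closed under `0, +, −` —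
computed by tools/conn_cert.py, closure re-checked by `decide` below). DATA. -/
def diffList : List (BB.Mono 5 18) := [((0 : Fin 5), (0 : Fin 18)), ((0 : Fin 5), (6 : Fin 18)), ((0 : Fin 5), (12 : Fin 18)), ((1 : Fin 5), (0 : Fin 18)), ((1 : Fin 5), (6 : Fin 18)), ((1 : Fin 5), (12 : Fin 18)), ((2 : Fin 5), (0 : Fin 18)), ((2 : Fin 5), (6 : Fin 18)), ((2 : Fin 5), (12 : Fin 18)), ((3 : Fin 5), (0 : Fin 18)), ((3 : Fin 5), (6 : Fin 18)), ((3 : Fin 5), (12 : Fin 18)), ((4 : Fin 5), (0 : Fin 18)), ((4 : Fin 5), (6 : Fin 18)), ((4 : Fin 5), (12 : Fin 18))]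

set_option maxRecDepth 100000 in
/-- `diffList` contains `0`, is closed under addition and under negation (`decide`). -/
theorem diffList_closed : (((0 : Fin 5), (0 : Fin 18)) : BB.Mono 5 18) ∈ diffList ∧
    (∀ a b : BB.Mono 5 18, a ∈ diffList → b ∈ diffList → a + b ∈ diffList) ∧
    (∀ a : BB.Mono 5 18, a ∈ diffList → -a ∈ diffList) := by
  refine ⟨by decide +kernel, by decide +kernel, by decide +kernel⟩

/-- `⟨S⟩` as an additive subgroup with carrier `diffList`. (definition) -/
def diffSub : AddSubgroup (BB.Mono 5 18) where
  carrier := {x | x ∈ diffList}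
  zero_mem' := diffList_closed.1
  add_mem' := fun {a b} ha hb => diffList_closed.2.1 a b ha hb
  neg_mem' := fun {a} ha => diffList_closed.2.2 a ha

set_option maxRecDepth 100000 in
/-- Every exponent difference inside `A` and inside `B` lies in `diffList` (`decide` over all pairs of `ℤ_5 × ℤ_18`). -/
theorem diffs_mem : (∀ g g' : BB.Mono 5 18, qc.A g ≠ 0 → qc.A g' ≠ 0 → g - g' ∈ diffList) ∧
    (∀ g g' : BB.Mono 5 18, qc.B g ≠ 0 → qc.B g' ≠ 0 → g - g' ∈ diffList) := by
  refine ⟨by decide +kernel, by decide +kernel⟩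

/-- Hence `expDiffSubgroup qc ≤ diffSub`. -/
theorem expDiffSubgroup_le : qc.expDiffSubgroup ≤ diffSub :=
  (AddSubgroup.closure_le diffSub).2 (by
    rintro d (⟨g, g', hg, hg', rfl⟩ | ⟨g, g', hg, hg', rfl⟩)
    · exact diffs_mem.1 g g' hg hg'
    · exact diffs_mem.2 g g' hg hg')

set_option maxRecDepth 100000 in
/-- **The Tanner graph of `qc` is NOT connected** (Bravyi et al. 2024 Lemma 3: `⟨S⟩ ≠ ℤ_5 × ℤ_18` — the element
`(0, 1)` is not an exponent-difference combination). Census column «connected» = false for this row, KERNEL. -/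
theorem qc_tannerGraph_not_connected : ¬ qc.css.tannerGraph.Connected := fun h => by
  have htop := (qc.tannerGraph_connected_iff (fun h => absurd (congrFun h ((0 : Fin 5), (12 : Fin 18))) (by decide))
    (fun h => absurd (congrFun h ((0 : Fin 5), (6 : Fin 18))) (by decide))).1 h
  have hx : (((0 : Fin 5), (1 : Fin 18)) : BB.Mono 5 18) ∈ diffSub := expDiffSubgroup_le (htop ▸ AddSubgroup.mem_top _)
  have hx' : (((0 : Fin 5), (1 : Fin 18)) : BB.Mono 5 18) ∈ diffList := hx
  exact absurd hx' (by decide)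

set_option maxRecDepth 100000 in
/-- Conversely every element of `diffList` IS an exponent-difference combination (BFS certificate from `0`: each element = an
earlier one + one difference inside `A` or `B`; tools/conn_cert.py), so `⟨S⟩ = diffSub` exactly. -/
theorem diffList_le : ∀ x : BB.Mono 5 18, x ∈ diffList → x ∈ qc.expDiffSubgroup := by
  have m0 : (((0 : Fin 5), (0 : Fin 18)) : BB.Mono 5 18) ∈ qc.expDiffSubgroup := qc.expDiffSubgroup.zero_mem
  have m1 : (((4 : Fin 5), (12 : Fin 18)) : BB.Mono 5 18) ∈ qc.expDiffSubgroup := by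
    have e : (((4 : Fin 5), (12 : Fin 18)) : BB.Mono 5 18) =
        ((0 : Fin 5), (0 : Fin 18)) + (((0 : Fin 5), (12 : Fin 18)) - (1, 0)) := by decide
    rw [e]
    exact qc.expDiffSubgroup.add_mem m0 (qc.sub_mem_expDiffSubgroup_A (by decide) (by decide))
  have m2 : (((1 : Fin 5), (12 : Fin 18)) : BB.Mono 5 18) ∈ qc.expDiffSubgroup := by
    have e : (((1 : Fin 5), (12 : Fin 18)) : BB.Mono 5 18) =
        ((0 : Fin 5), (0 : Fin 18)) + (((0 : Fin 5), (12 : Fin 18)) - (4, 0)) := by decide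
    rw [e]
    exact qc.expDiffSubgroup.add_mem m0 (qc.sub_mem_expDiffSubgroup_A (by decide) (by decide))
  have m3 : (((1 : Fin 5), (6 : Fin 18)) : BB.Mono 5 18) ∈ qc.expDiffSubgroup := by
    have e : (((1 : Fin 5), (6 : Fin 18)) : BB.Mono 5 18) =
        ((0 : Fin 5), (0 : Fin 18)) + (((1 : Fin 5), (0 : Fin 18)) - (0, 12)) := by decide
    rw [e]
    exact qc.expDiffSubgroup.add_mem m0 (qc.sub_mem_expDiffSubgroup_A (by decide) (by decide))
  have m4 : (((2 : Fin 5), (0 : Fin 18)) : BB.Mono 5 18) ∈ qc.expDiffSubgroup := by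
    have e : (((2 : Fin 5), (0 : Fin 18)) : BB.Mono 5 18) =
        ((0 : Fin 5), (0 : Fin 18)) + (((1 : Fin 5), (0 : Fin 18)) - (4, 0)) := by decide
    rw [e]
    exact qc.expDiffSubgroup.add_mem m0 (qc.sub_mem_expDiffSubgroup_A (by decide) (by decide))
  have m5 : (((4 : Fin 5), (6 : Fin 18)) : BB.Mono 5 18) ∈ qc.expDiffSubgroup := by
    have e : (((4 : Fin 5), (6 : Fin 18)) : BB.Mono 5 18) =
        ((0 : Fin 5), (0 : Fin 18)) + (((4 : Fin 5), (0 : Fin 18)) - (0, 12)) := by decide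
    rw [e]
    exact qc.expDiffSubgroup.add_mem m0 (qc.sub_mem_expDiffSubgroup_A (by decide) (by decide))
  have m6 : (((3 : Fin 5), (0 : Fin 18)) : BB.Mono 5 18) ∈ qc.expDiffSubgroup := by
    have e : (((3 : Fin 5), (0 : Fin 18)) : BB.Mono 5 18) =
        ((0 : Fin 5), (0 : Fin 18)) + (((4 : Fin 5), (0 : Fin 18)) - (1, 0)) := by decide
    rw [e]
    exact qc.expDiffSubgroup.add_mem m0 (qc.sub_mem_expDiffSubgroup_A (by decide) (by decide))
  have m7 : (((3 : Fin 5), (6 : Fin 18)) : BB.Mono 5 18) ∈ qc.expDiffSubgroup := by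
    have e : (((3 : Fin 5), (6 : Fin 18)) : BB.Mono 5 18) =
        ((0 : Fin 5), (0 : Fin 18)) + (((0 : Fin 5), (6 : Fin 18)) - (2, 0)) := by decide
    rw [e]
    exact qc.expDiffSubgroup.add_mem m0 (qc.sub_mem_expDiffSubgroup_B (by decide) (by decide))
  have m8 : (((2 : Fin 5), (6 : Fin 18)) : BB.Mono 5 18) ∈ qc.expDiffSubgroup := by
    have e : (((2 : Fin 5), (6 : Fin 18)) : BB.Mono 5 18) =
        ((0 : Fin 5), (0 : Fin 18)) + (((0 : Fin 5), (6 : Fin 18)) - (3, 0)) := by decide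
    rw [e]
    exact qc.expDiffSubgroup.add_mem m0 (qc.sub_mem_expDiffSubgroup_B (by decide) (by decide))
  have m9 : (((2 : Fin 5), (12 : Fin 18)) : BB.Mono 5 18) ∈ qc.expDiffSubgroup := by
    have e : (((2 : Fin 5), (12 : Fin 18)) : BB.Mono 5 18) =
        ((0 : Fin 5), (0 : Fin 18)) + (((2 : Fin 5), (0 : Fin 18)) - (0, 6)) := by decide
    rw [e]
    exact qc.expDiffSubgroup.add_mem m0 (qc.sub_mem_expDiffSubgroup_B (by decide) (by decide))
  have m10 : (((4 : Fin 5), (0 : Fin 18)) : BB.Mono 5 18) ∈ qc.expDiffSubgroup := by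
    have e : (((4 : Fin 5), (0 : Fin 18)) : BB.Mono 5 18) =
        ((0 : Fin 5), (0 : Fin 18)) + (((2 : Fin 5), (0 : Fin 18)) - (3, 0)) := by decide
    rw [e]
    exact qc.expDiffSubgroup.add_mem m0 (qc.sub_mem_expDiffSubgroup_B (by decide) (by decide))
  have m11 : (((3 : Fin 5), (12 : Fin 18)) : BB.Mono 5 18) ∈ qc.expDiffSubgroup := by
    have e : (((3 : Fin 5), (12 : Fin 18)) : BB.Mono 5 18) =
        ((0 : Fin 5), (0 : Fin 18)) + (((3 : Fin 5), (0 : Fin 18)) - (0, 6)) := by decide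
    rw [e]
    exact qc.expDiffSubgroup.add_mem m0 (qc.sub_mem_expDiffSubgroup_B (by decide) (by decide))
  have m12 : (((1 : Fin 5), (0 : Fin 18)) : BB.Mono 5 18) ∈ qc.expDiffSubgroup := by
    have e : (((1 : Fin 5), (0 : Fin 18)) : BB.Mono 5 18) =
        ((0 : Fin 5), (0 : Fin 18)) + (((3 : Fin 5), (0 : Fin 18)) - (2, 0)) := by decide
    rw [e]
    exact qc.expDiffSubgroup.add_mem m0 (qc.sub_mem_expDiffSubgroup_B (by decide) (by decide))
  have m13 : (((0 : Fin 5), (6 : Fin 18)) : BB.Mono 5 18) ∈ qc.expDiffSubgroup := by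
    have e : (((0 : Fin 5), (6 : Fin 18)) : BB.Mono 5 18) =
        ((4 : Fin 5), (12 : Fin 18)) + (((0 : Fin 5), (12 : Fin 18)) - (4, 0)) := by decide
    rw [e]
    exact qc.expDiffSubgroup.add_mem m1 (qc.sub_mem_expDiffSubgroup_A (by decide) (by decide))
  have m14 : (((0 : Fin 5), (12 : Fin 18)) : BB.Mono 5 18) ∈ qc.expDiffSubgroup := by
    have e : (((0 : Fin 5), (12 : Fin 18)) : BB.Mono 5 18) =
        ((4 : Fin 5), (12 : Fin 18)) + (((3 : Fin 5), (0 : Fin 18)) - (2, 0)) := by decide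
    rw [e]
    exact qc.expDiffSubgroup.add_mem m1 (qc.sub_mem_expDiffSubgroup_B (by decide) (by decide))
  simp only [diffList, List.forall_mem_cons]
  exact ⟨m0, m13, m14, m12, m3, m2, m4, m8, m9, m6, m7, m11, m10, m5, m1, by simp⟩

/-- `⟨S⟩ = diffSub` (`15` elements). -/
theorem expDiffSubgroup_eq : qc.expDiffSubgroup = diffSub :=
  le_antisymm expDiffSubgroup_le (fun x hx => diffList_le x hx)

set_option maxRecDepth 100000 in
/-- `|⟨S⟩| = 15`. -/
theorem card_expDiffSubgroup : Nat.card qc.expDiffSubgroup = 15 := by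
  rw [expDiffSubgroup_eq]
  change Nat.card {x : BB.Mono 5 18 // x ∈ diffList} = 15
  rw [Nat.card_eq_fintype_card]
  decide +kernel

set_option maxRecDepth 100000 in
/-- **The Tanner graph of `qc` has exactly `6` connected components** (BCGMRY24 Lemma 3 (ii): `#components · |⟨S⟩| = ℓm`,
`90 / 15 = 6`); with the tree's connected normal form (`TwoBlockConnectedComponents.lean`) the code is the disjoint union of
`6` copies of the root two-block code over `⟨S⟩` — numerically `6 × [[30, 8, 4]]`. KERNEL. -/
theorem qc_card_connectedComponent : Nat.card qc.css.tannerGraph.ConnectedComponent = 6 := by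
  have h := qc.card_connectedComponent_mul_card
    (fun h => absurd (congrFun h ((0 : Fin 5), (12 : Fin 18))) (by decide))
    (fun h => absurd (congrFun h ((0 : Fin 5), (6 : Fin 18))) (by decide))
  rw [card_expDiffSubgroup] at h
  omega

set_option maxRecDepth 100000 in
/-- **`qc`**: Tanner graph = edge-disjoint union of two layers whose components are wheel graphs `prismGraph 10` (`A₃A₂ᵀ` of order
`5`) and `prismGraph 30` (`B₂B₁ᵀ` of order `15`) — BCGMRY24 Lemma 2 minus planarity (`BB.Code.exists_wheel_layers`). KERNEL. -/
theorem qc_wheel_layers :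
    ∃ ΓA ΓB : SimpleGraph ((BB.Mono 5 18 ⊕ BB.Mono 5 18) ⊕ (BB.Mono 5 18 ⊕ BB.Mono 5 18)),
    qc.css.tannerGraph = ΓA ⊔ ΓB ∧ Disjoint ΓA ΓB ∧
    (∀ K : ΓA.ConnectedComponent, Nonempty (K.toSimpleGraph ≃g prismGraph 10)) ∧
    (∀ K : ΓB.ConnectedComponent, Nonempty (K.toSimpleGraph ≃g prismGraph 30)) := by
  have hA : ∀ g : BB.Mono 5 18, qc.A g ≠ 0 ↔ g = ((0 : Fin 5), (12 : Fin 18)) ∨ g = ((1 : Fin 5), (0 : Fin 18)) ∨ g = ((4 : Fin 5), (0 : Fin 18)) := by decide +kernel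
  have hB : ∀ g : BB.Mono 5 18, qc.B g ≠ 0 ↔ g = ((0 : Fin 5), (6 : Fin 18)) ∨ g = ((2 : Fin 5), (0 : Fin 18)) ∨ g = ((3 : Fin 5), (0 : Fin 18)) := by decide +kernel
  have h := qc.exists_wheel_layers (g₁ := ((0 : Fin 5), (12 : Fin 18))) (g₂ := ((1 : Fin 5), (0 : Fin 18))) (g₃ := ((4 : Fin 5), (0 : Fin 18))) (h₁ := ((0 : Fin 5), (6 : Fin 18)))
    (h₂ := ((2 : Fin 5), (0 : Fin 18))) (h₃ := ((3 : Fin 5), (0 : Fin 18))) (by decide) (by decide) (by decide) (by decide) (by decide) (by decide) hA hB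
  have e1 : addOrderOf (((4 : Fin 5), (0 : Fin 18)) - (1, 0)) = 5 := (addOrderOf_eq_iff (by norm_num)).mpr (by decide)
  have e2 : addOrderOf (((2 : Fin 5), (0 : Fin 18)) - (0, 6)) = 15 := (addOrderOf_eq_iff (by norm_num)).mpr (by decide)
  rw [e1, e2] at h
  exact h

end Summit.Ventures.QEC.Census.A1s_n180_k48_73c9e5d1

namespace Summit.Ventures.QEC.Census.A1s_n18_k4_63a6067b

open Matrix Literature.InformationTheory.QuantumCodes BBRows

/-- Monomials of `A = 1 + y + x` (certificate `A_terms = [[0, 0], [0, 1], [1, 0]]`). DATA. -/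
def la : List (BB.Mono 3 3) := [(Fin.ofNat 3 0, Fin.ofNat 3 0), (Fin.ofNat 3 0, Fin.ofNat 3 1), (Fin.ofNat 3 1, Fin.ofNat 3 0)]

/-- Monomials of `B = 1 + y^2 + x^2` (certificate `B_terms = [[0, 0], [0, 2], [2, 0]]`). DATA. -/
def lb : List (BB.Mono 3 3) := [(Fin.ofNat 3 0, Fin.ofNat 3 0), (Fin.ofNat 3 0, Fin.ofNat 3 2), (Fin.ofNat 3 2, Fin.ofNat 3 0)]

/-- The census row's code as a TYPED two-block code `QC(1 + y + x, 1 + y^2 + x^2)` on `ℤ_3 × ℤ_3` (`BB.Code 3 3`). (definition) -/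
def qc : BB.Code 3 3 := ⟨polyL la, polyL lb⟩

set_option maxRecDepth 100000 in
/-- INDEX IDENTITY, `X` side, in the kernel: the certificate's `H^X` rows ARE the `X`-check words of `qc` (`decide +kernel`). -/
theorem HX_eq_rowsX : A1s_n18_k4_63a6067b.cert.HX = rowsX la lb := by
  decide +kernel

set_option maxRecDepth 100000 in
/-- INDEX IDENTITY, `Z` side. -/
theorem HZ_eq_rowsZ : A1s_n18_k4_63a6067b.cert.HZ = rowsZ la lb := by
  decide +kernel

set_option maxRecDepth 100000 in
/-- The certificate's flat `H^X` is `qc.HXFlat`. -/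
theorem rowMatrix_HX_eq : rowMatrix 18 A1s_n18_k4_63a6067b.cert.HX = qc.HXFlat := by
  have cast : ∀ {H H' : List ℕ} (e : H = H'),
      rowMatrix 18 H = (rowMatrix 18 H').submatrix (Fin.cast (congrArg List.length e)) id := by
    intro H H' e; subst e; rfl
  exact (cast HX_eq_rowsX).trans (rowMatrix_rowsX qc (LA := la) (LB := lb) rfl rfl)

set_option maxRecDepth 100000 in
/-- The certificate's flat `H^Z` is `qc.HZFlat`. -/
theorem rowMatrix_HZ_eq : rowMatrix 18 A1s_n18_k4_63a6067b.cert.HZ = qc.HZFlat := by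
  have cast : ∀ {H H' : List ℕ} (e : H = H'),
      rowMatrix 18 H = (rowMatrix 18 H').submatrix (Fin.cast (congrArg List.length e)) id := by
    intro H H' e; subst e; rfl
  exact (cast HZ_eq_rowsZ).trans (rowMatrix_rowsZ qc (LA := la) (LB := lb) rfl rfl)

set_option maxRecDepth 100000 in
/-- `d^Z (qc) = 4`, transported from the census certificate (`A1s_n18_k4_63a6067b.dZ_eq`) by `BB.Code.dZ_eq_of_flat`. -/
theorem qc_dZ : qc.css.dZ = 4 :=
  (qc.dZ_eq_of_flat (D := A1s_n18_k4_63a6067b.cert.code A1s_n18_k4_63a6067b.commOK_cert)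
    rowMatrix_HX_eq rowMatrix_HZ_eq).symm.trans A1s_n18_k4_63a6067b.dZ_eq

set_option maxRecDepth 100000 in
/-- `k (qc) = 4`, transported from the census certificate (`A1s_n18_k4_63a6067b.k_eq`) by `BB.Code.k_eq_of_flat`. -/
theorem qc_k : qc.k = 4 :=
  (qc.k_eq_of_flat (D := A1s_n18_k4_63a6067b.cert.code A1s_n18_k4_63a6067b.commOK_cert)
    rowMatrix_HX_eq rowMatrix_HZ_eq).symm.trans A1s_n18_k4_63a6067b.k_eq

/-- **`QC(1 + y + x, 1 + y^2 + x^2)` on `ℤ_3 × ℤ_3` has parameters `[[18, 4, 4]]`** (distance exact; `BB.HasParams`) — the census row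
`A1s_n18_k4_63a6067b` read as a statement about the construction. KERNEL. -/
theorem qc_hasParams : Summit.Ventures.QEC.BB.HasParams qc 18 4 4 :=
  BB.hasParams_of_dZ (by simp only [BB.numQubits_eq]) qc_k qc_dZ

/-- The same in the generic census vocabulary: `qc.css.IsCode 18 4 4`. -/
theorem qc_isCode : qc.css.IsCode 18 4 4 :=
  (BB.hasParams_iff_isCode (by decide)).1 qc_hasParams


set_option maxRecDepth 100000 in
/-- **The Tanner graph of `qc` is connected** (Bravyi et al. 2024 Lemma 3 / `BB.Code.tannerGraph_connected_of_unit_mem`): `x = (1,0)`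
and `y = (0,1)` are explicit combinations of exponent differences inside `A` or inside `B` (found by qec-type-05's tools/conn_cert.py,
re-checked by `decide`). Census column «connected» for this row, KERNEL. -/
theorem qc_tannerGraph_connected : qc.css.tannerGraph.Connected := by
  refine qc.tannerGraph_connected_of_unit_mem (fun h => absurd (congrFun h ((0 : Fin 3), (0 : Fin 3))) (by decide))
    (fun h => absurd (congrFun h ((0 : Fin 3), (0 : Fin 3))) (by decide)) ?_ ?_
  · have e : (((1 : Fin 3), (0 : Fin 3)) : BB.Mono 3 3) = (2 : ℕ) • (((0 : Fin 3), (0 : Fin 3)) - (1, 0)) := by decide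
    rw [e]
    exact (AddSubgroup.nsmul_mem _ (qc.sub_mem_expDiffSubgroup_A (by decide) (by decide)) 2)
  · have e : (((0 : Fin 3), (1 : Fin 3)) : BB.Mono 3 3) = (2 : ℕ) • (((0 : Fin 3), (0 : Fin 3)) - (0, 1)) := by decide
    rw [e]
    exact (AddSubgroup.nsmul_mem _ (qc.sub_mem_expDiffSubgroup_A (by decide) (by decide)) 2)

/-- The two layout generators `A_iA_jᵀ ↦ (0, 0) − (0, 1)` and `B_gB_hᵀ ↦ (0, 0) − (2, 0)` generate `ℤ_3 × ℤ_3`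
(explicit multiples giving `x` and `y`, `decide`d). -/
theorem qc_layout_closure_eq_top : AddSubgroup.closure ({((0 : Fin 3), (0 : Fin 3)) - (0, 1), ((0 : Fin 3), (0 : Fin 3)) - (2, 0)} : Set (BB.Mono 3 3)) = ⊤ := by
  apply BB.Code.addSubgroup_eq_top_of_unit_mem
  · have h1 := AddSubgroup.subset_closure (k := ({((0 : Fin 3), (0 : Fin 3)) - (0, 1), ((0 : Fin 3), (0 : Fin 3)) - (2, 0)} : Set (BB.Mono 3 3))) (Set.mem_insert _ _)
    have h2 := AddSubgroup.subset_closure (k := ({((0 : Fin 3), (0 : Fin 3)) - (0, 1), ((0 : Fin 3), (0 : Fin 3)) - (2, 0)} : Set (BB.Mono 3 3))) (Set.mem_insert_of_mem _ rfl)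
    have e : (0 : ℕ) • (((0 : Fin 3), (0 : Fin 3)) - (0, 1)) + (1 : ℕ) • (((0 : Fin 3), (0 : Fin 3)) - (2, 0)) = (1, 0) := by decide
    have h' := AddSubgroup.add_mem _ (AddSubgroup.nsmul_mem _ h1 0) (AddSubgroup.nsmul_mem _ h2 1)
    rw [e] at h'
    exact h'
  · have h1 := AddSubgroup.subset_closure (k := ({((0 : Fin 3), (0 : Fin 3)) - (0, 1), ((0 : Fin 3), (0 : Fin 3)) - (2, 0)} : Set (BB.Mono 3 3))) (Set.mem_insert _ _)
    have h2 := AddSubgroup.subset_closure (k := ({((0 : Fin 3), (0 : Fin 3)) - (0, 1), ((0 : Fin 3), (0 : Fin 3)) - (2, 0)} : Set (BB.Mono 3 3))) (Set.mem_insert_of_mem _ rfl)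
    have e : (2 : ℕ) • (((0 : Fin 3), (0 : Fin 3)) - (0, 1)) + (0 : ℕ) • (((0 : Fin 3), (0 : Fin 3)) - (2, 0)) = (0, 1) := by decide
    have h' := AddSubgroup.add_mem _ (AddSubgroup.nsmul_mem _ h1 2) (AddSubgroup.nsmul_mem _ h2 0)
    rw [e] at h'
    exact h'

set_option maxRecDepth 100000 in
/-- Orders of the two layout generators: `3` and `3` (product `9 = ℓm`). -/
theorem qc_layout_orders : addOrderOf (((0 : Fin 3), (0 : Fin 3)) - (0, 1)) = 3 ∧ addOrderOf (((0 : Fin 3), (0 : Fin 3)) - (2, 0)) = 3 :=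
  ⟨(addOrderOf_eq_iff (by norm_num)).mpr (by decide), (addOrderOf_eq_iff (by norm_num)).mpr (by decide)⟩

/-- **`qc` has a toric layout with `(μ, λ) = (3, 3)`** (Bravyi et al. 2024 Lemma 4 / `BB.Code.hasToricLayoutWith_of_exponents`):
census layout column, KERNEL. -/
theorem qc_hasToricLayoutWith : HasToricLayoutWith 3 3 qc.css.tannerGraph := by
  have h := qc.hasToricLayoutWith_of_exponents (g := ((0 : Fin 3), (0 : Fin 3))) (g' := (0, 1))
    (h := ((0 : Fin 3), (0 : Fin 3))) (h' := (2, 0)) (by decide) (by decide) (by decide) (by decide)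
    qc_layout_closure_eq_top (by rw [qc_layout_orders.1, qc_layout_orders.2])
  rwa [qc_layout_orders.1, qc_layout_orders.2] at h

/-- `qc` has a toric layout. KERNEL. -/
theorem qc_hasToricLayout : HasToricLayout qc.css.tannerGraph :=
  ⟨3, 3, by norm_num, by norm_num, qc_hasToricLayoutWith⟩

set_option maxRecDepth 100000 in
/-- **`qc`**: Tanner graph = edge-disjoint union of two layers whose components are wheel graphs `prismGraph 6` (`A₃A₂ᵀ` of order
`3`) and `prismGraph 6` (`B₂B₁ᵀ` of order `3`) — BCGMRY24 Lemma 2 minus planarity (`BB.Code.exists_wheel_layers`). KERNEL. -/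
theorem qc_wheel_layers :
    ∃ ΓA ΓB : SimpleGraph ((BB.Mono 3 3 ⊕ BB.Mono 3 3) ⊕ (BB.Mono 3 3 ⊕ BB.Mono 3 3)),
    qc.css.tannerGraph = ΓA ⊔ ΓB ∧ Disjoint ΓA ΓB ∧
    (∀ K : ΓA.ConnectedComponent, Nonempty (K.toSimpleGraph ≃g prismGraph 6)) ∧
    (∀ K : ΓB.ConnectedComponent, Nonempty (K.toSimpleGraph ≃g prismGraph 6)) := by
  have hA : ∀ g : BB.Mono 3 3, qc.A g ≠ 0 ↔ g = ((0 : Fin 3), (0 : Fin 3)) ∨ g = ((0 : Fin 3), (1 : Fin 3)) ∨ g = ((1 : Fin 3), (0 : Fin 3)) := by decide +kernel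
  have hB : ∀ g : BB.Mono 3 3, qc.B g ≠ 0 ↔ g = ((0 : Fin 3), (0 : Fin 3)) ∨ g = ((0 : Fin 3), (2 : Fin 3)) ∨ g = ((2 : Fin 3), (0 : Fin 3)) := by decide +kernel
  have h := qc.exists_wheel_layers (g₁ := ((0 : Fin 3), (0 : Fin 3))) (g₂ := ((0 : Fin 3), (1 : Fin 3))) (g₃ := ((1 : Fin 3), (0 : Fin 3))) (h₁ := ((0 : Fin 3), (0 : Fin 3)))
    (h₂ := ((0 : Fin 3), (2 : Fin 3))) (h₃ := ((2 : Fin 3), (0 : Fin 3))) (by decide) (by decide) (by decide) (by decide) (by decide) (by decide) hA hB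
  have e1 : addOrderOf (((1 : Fin 3), (0 : Fin 3)) - (0, 1)) = 3 := (addOrderOf_eq_iff (by norm_num)).mpr (by decide)
  have e2 : addOrderOf (((0 : Fin 3), (2 : Fin 3)) - (0, 0)) = 3 := (addOrderOf_eq_iff (by norm_num)).mpr (by decide)
  rw [e1, e2] at h
  exact h

end Summit.Ventures.QEC.Census.A1s_n18_k4_63a6067b
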